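import Mathlib
import Literature.MathematicalPhysics.QuantumFieldTheory.Balaban1983to89.B5Ineq167LowerZd

/-!
# Dimock, *The renormalization group according to Balaban* I §3.2 Lemma `strong` (1), II §3.2 Definition 3.s with
# LEMMAS 3.1 (1) / 3.2 (1), and II §3.5 LEMMA `suddsy` (gb2): the small-field conditions
# `|Φ_k − Q_kφ| ≤ p_k`, `|∂φ| ≤ p_k`, `|φ| ≤ p_kα_k⁻¹` FORCE `|Φ_k| ≤ 2p_kα_k⁻¹`, `|∂Φ_k| ≤ 3p_k`, and one level up
# `|Φ_{k+1} − QΦ_k| ≤ p_k` FORCES `|Φ_{k+1}| ≤ 3p_kα_k⁻¹`, `|∂Φ_{k+1}| ≤ 4p_k` — PROVED on the tree's `ℤ^d` block geometry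

**Citation header (reproduction of PUBLISHED work; template of the Bałaban lattice Yang–Mills cell).**
J. Dimock, *The renormalization group according to Balaban. I. Small fields*, Rev. Math. Phys. **25** (2013)
1330010 (= arXiv:1108.1335v2) [Dimock2013], §3.2 "small fields" (`\subsection{small fields}` TeX L1190; §3 =
`\section{Localized functionals of the field}` L1137, §3.1 = "overview" L1141): Definition of `𝒮_k` (sk) (= DEFINITION 1
of the global `defn` counter) TeX L1206–1215 and LEMMA `\label{strong}` (= LEMMA 8: `\newtheorem{lem}[thm]{Lemma}` shares
the counter with Theorem 1 `major` and Corollary 7) L1243–1249 with its proof L1252–1266 (TeX source held by the cell, `inputs/files/dimock/src/1108.1335/1108.1335.tex`,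
sha256[:16] 7382e6540dded9be, 4263 lines).  J. Dimock, *The renormalization group according to Balaban. II. Large
fields*, J. Math. Phys. **54** (2013) 092301 (= arXiv:1212.5562v2) [Dimock2013BalabanII], §3.2 "bounds on fields":
DEFINITION `\label{s}` (= Definition 3.s; (yass1)/(yass2)) L2063–2078, "well-inside" L2094, LEMMA `\label{threeone}` (the
first `\begin{lem}` of §3 = Lemma 3.1 of the printed numbering, TEMPLATE.md §9) L2103–2116 with *"Proof. [Bal82b],
[Bal95]"* L2119 and the proof of part (1.) (base1)/(base2) L2123–2138, LEMMA `\label{threetwo}` (= Lemma 3.2) L2220–2235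
with L2237; §3.5: (sub) L2741–2743 and LEMMA `\label{suddsy}` (= Lemma 3.4, the fourth `\begin{lem}` of §3) L2808–2822 with its
proof L2827–2856 (TeX
`inputs/files/dimock/src/1212.5562/1212.5562.tex`, 75c5792fc48eacbc, 7217 lines).  Use site in part III
[Dimock2013BalabanIII] §1 item L279–283.  Dimock's papers are published and refereed and are the cell's TEMPLATE, not
manuscripts under audit; no quantity of the Bałaban series is touched.

**What the papers print (verbatim).**  I L1206–1215: *"𝒮_k is all functions Φ_k : 𝕋⁰_{M+N−k} → ℝ such that with φ_k =
a_k G_k Q_k^T Φ_k on 𝕋^{−k}_{N+M−k}:  |Φ_k − Q_kφ_k| ≤ p_k,  |∂φ_k| ≤ p_k,  |φ_k| ≤ λ_k^{−1/4} p_k"*.  I LEMMA `strong`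
(L1243–1249): *"Let Φ_k ∈ 𝒮_k. Then 1. |Φ_k| ≤ 2p_kλ_k^{−1/4} and |∂_μΦ_k| ≤ 3p_k.  2. For λ_k sufficiently small φ_k =
a_kG_kQ_k^TΦ_k ∈ ℛ_k"*; proof of 1. (L1252–1266): *"|Φ_k| ≤ |Φ_k − Q_kφ_k| + |Q_kφ_k| ≤ p_k + p_kλ_k^{−1/4} ≤ 2p_kλ_k^{−1/4}
and also |(∂_μΦ_k)(x)| = |(Φ_k)(x + e_μ) − (Φ_k)(x)| ≤ |Q_kφ_k(x + e_μ) − Q_kφ_k(x)| + 2p_k ≤ ‖∂φ_k‖_∞ + 2p_k ≤ 3p_k"*.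
II L2050–2058: *"A basic parameter here is p_k = p(λ_k) = (−log λ_k)^p … Also define α_k = max{μ̄_k^{1/2}, λ_k^{1/4}}"*.
II DEFINITION 3.s (L2063–2078): *"For □ ⊂ Ω_k, 𝒮_k(□) is all (Φ_{k−1,Ω_{k−1}}, Φ_{k,Ω_k}) such that  |Φ_k − Q_kφ_{k,Ω(□)}| ≤
p_k on □̃ ∩ Ω_k,  |∂φ_{k,Ω(□)}| ≤ p_k on □̃,  |φ_{k,Ω(□)}| ≤ p_kα_k^{−1} on □̃  (yass1)  If X is a union of M-cubes 𝒮_k(X) =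
⋂_{□⊂X} 𝒮_k(□) (yass2)"*.  II L2094–2095: *"We say that □ is well-inside Ω_k if □^{∼(2R+1)} ⊂ Ω_k. In this case 𝒮_k(□)
is a condition on Φ_k alone, and the bounds are more or less equivalent to bounds on Φ_k, ∂Φ_k for we have the
following result:"*  II LEMMA 3.1 (L2103–2116): *"Let □ be well-inside Ω_k  1. If Φ_k ∈ 𝒮_k(□) then on □̃  |Φ_k| ≤
2p_kα_k^{−1}   |∂Φ_k| ≤ 3p_k  (scone2)  2. Conversely if μ̄ ≤ 1 and on □^{∼(2R+1)}  |Φ_k| ≤ p_kα_k^{−1}  |∂Φ_k| ≤ p_k  then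
Φ_k ∈ C𝒮_k(□), i.e. the bounds (yass1) hold with a constant C on the right."*  *"Proof. [Bal82b], [Bal95]  (1.) For x ⊂
□̃  |Φ_k(x)| ≤ |Φ_k(x) − Q_kφ_{k,Ω(□)}(x)| + |Q_kφ_{k,Ω(□)}(x))| ≤ 2p_kα_k^{−1}  (base1)  Also for x, x + e_μ ∈ □̃
|(∂_μΦ_k)(x)| = |(Φ_k)(x + e_μ) − (Φ_k)(x)| ≤ |Q_kφ_{k,Ω(□)}(x + e_μ) − Q_kφ_{k,Ω(□)}(x)| + 2p_k ≤ sup_{x∈□̃} |∂φ_{k,Ω(□)}(x)|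
+ 2p_k ≤ 3p_k  (base2)  This proves the first part."* (L2119–2138).  II LEMMA 3.2 (L2220–2235): *"Let □ ⊂ Ω_k.  1. If
(Φ_{k−1,Ω_{k−1}}, Φ_{k,Ω_k}) ∈ 𝒮_k(□) then on □̃ ∩ Ω_k  |Φ_k| ≤ 2p_kα_k^{−1}   |∂Φ_k| ≤ 3p_k  2. Conversely …"*; *"This is
proved as in the previous lemma"* (L2237).  II (sub) L2741–2743: *"|Φ_{k+1} − QΦ_k| ≤ p_k on Ω_{k+1}"*.  II LEMMA `suddsy`
(L2808–2822): *"The characteristic functions enforce the following bounds:  |Φ_k| ≤ 3p_{k−1}α_{k−1}^{−1}L^{1/2}   |∂Φ_k| ≤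
4p_{k−1}L^{3/2}  on Ω_k − Λ_k  (gb1)   |Φ_k| ≤ 2p_kα_k^{−1}   |∂Φ_k| ≤ 3p_k  on Λ̃_k  (gb1.5)   |Φ_{k+1}| ≤ 3p_kα_k^{−1}
|∂Φ_{k+1}| ≤ 4p_k  on Ω_{k+1}  (gb2)  In addition Φ^#_{k+1} = (QΦ_{k,δΩ_k}, Φ_{k+1,Ω_{k+1}}) satisfies  |Φ^#_{k+1}| ≤ Cp_kα_k^{−1}
|∂Φ^#_{k+1}| ≤ Cp_k on Ω_k  (gb2.5)"*.  Proof (L2827–2856): *"The characteristic function 𝒞_{k,π} enforces the bounds (gb1)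
on Ω_k − Λ_k by assumption. The function χ_k(Λ_k) says that for □ ⊂ Λ_k we have Φ_k ∈ 𝒮_k(□). Then by lemma 3.1 we have
on □̃ the bounds |Φ_k| ≤ 2p_kα_k^{−1} and |∂Φ_k| ≤ 3p_k. This gives (gb1.5).  The first bound in (gb1.5) and (sub) give
|Φ_{k+1}| ≤ 3p_kα_k^{−1/4} ⟦sic: α_k^{−1}, as in (gb2)⟧ on Ω_{k+1}. The second bound follows by (sub) as well by the estimate
for y, y + Le_μ ∈ Ω_k^{(k+1)}  |∂_μΦ_{k+1}(y)| = L^{−1}|Φ_{k+1}(y + Le_μ) − Φ_{k+1}(y)| ≤ L^{−1}|(QΦ_k)(y + Le_μ) − QΦ_k(y)| +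
L^{−1}2p_k ≤ 3p_k + L^{−1}2p_k ≤ 4p_k  Thus (gb2) is established.  For (gb2.5) note that (gb1), (gb1.5) imply that |Φ_k| ≤
Cp_kα_k^{−1} and |∂Φ_k| ≤ Cp_k on Ω_k. Hence QΦ_k satisfies the same bounds on δΩ_k, as does Φ_{k+1} on Ω_{k+1}. The
remaining issue is when a derivative crosses the boundary of Ω_{k+1}. This is handled as follows. Suppose y ∈ Ω_k^{(k+1)}
and y + Le_μ ∈ Ω_{k+1}^{(k+1)}. Then (∂_μΦ^#_{k+1})(y) = L^{−1}(Φ_{k+1}(y + Le_μ) − (QΦ_k)(y)) = L^{−1}(Φ_{k+1}(y + Le_μ) −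
(QΦ_k)(y + Le_μ)) + L^{−1}((QΦ_k)(y + Le_μ) − (QΦ_k)(y))  The first term is bounded by Cp_k by (sub) and the second term
is bounded by Cp_k by the bound on ∂Φ_k. This completes the proof."*  III L279–283: *"the characteristic function
χ_k(Λ_k) enforce bounds on Λ_k stronger than: |Φ_k| ≤ 2p_kα_k^{−1}  |∂Φ_k| ≤ 3p_k"*.

**What is reproduced here (kernel-checked, zero `sorry`).**  THE CARRIER is the `ℤ^d` block geometry ALREADY IN THE
TREE (`Balaban1983to89.B6QGQLower276`, unit b2b-balaban-pv19: sites `X d = Fin d → ℤ` of the fine lattice in integer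
coordinates, unit vectors `e μ`, block side `side n = n + 1` (= `L^k = η⁻¹` fine sites per unit length), block label
`blk`, blocks `B n y` of the unit-lattice point `y`, unions of blocks `U n S`; and `B5Ineq167LowerZd`, unit
b2b-balaban-pv23: the next-block chart `sum_B_add_e` and the telescoping identity `sub_eq_sum_range`) — USED BY NAME,
nothing re-declared.  On it:
* §1 the block average `qavg n f y = (n+1)^{−d} Σ_{p∈B(y)} f(p)` (= `(Q_kφ)(y)`, print I L462–469 / II L989–994), the
  fine-lattice derivative `fdFine n μ f x = (n+1)(f(x + e_μ) − f(x))` (= `∂_μφ`, spacing `η = (n+1)⁻¹`), the unit-lattice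
  derivative `fdUnit μ F y = F(y + e_μ) − F(y)` (= `∂_μΦ_k`), and the `L`-lattice derivative `fdCoarse m μ F u =
  (m+1)⁻¹(F(u + e_μ) − F(u))` (= `∂_μΦ_{k+1}` on `𝕋¹`, `L = m + 1`, the `L`-lattice point `Lu` labelled by `u ∈ ℤ^d`);
  the two [folklore] AVERAGING FACTS the printed proofs use without comment — `abs_qavg_le`: `|Qf(y)| ≤ sup_{B(y)}|f|`,
  and `abs_qavg_sub_le`: `|Qf(y + e_μ) − Qf(y)| ≤ (n+1)·sup |f(· + e_μ) − f|` over the `n+1` translates of `B(y)` towards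
  `B(y + e_μ)` (next-block chart + telescoping + averaging) — and the lattice fact `blk_add_steps` (a site of `B(y)` moved
  `t ≤ n+1` steps in direction `μ` lies in `B(y)` or in `B(y + e_μ)`);
* §2 **DEFINITION 3.s as a predicate** `LocalSmallField n p α S₀ S Φ φ` — the three bounds (yass1) for a pair (unit
  field `Φ`, fine field `φ`) with `□̃ ∩ Ω_k ↦ S₀` and `□̃ ↦ S` (finite sets of unit-lattice points; the fine sites of `S`
  are `U n S`) — and **LEMMA 3.1 (1) = LEMMA 3.2 (1) = I LEMMA `strong` (1)**: `lemma31_abs` (`|Φ_k| ≤ 2p_kα_k⁻¹` on `S₀`,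
  print (base1); needs `0 < α_k ≤ 1`) and `lemma31_fdUnit` (`|∂_μΦ_k| ≤ 3p_k` for `y, y + e_μ ∈ S₀`, print (base2)), for
  EVERY pair satisfying the predicate with `S₀ ⊆ S` — in print the fine field is the specific `φ_{k,Ω(□)}` (II) or
  `φ_k = a_kG_kQ_k^TΦ_k` (I), but part (1.) uses only the three bounds, which is what is formalised; I's global lemma is
  the case `S₀ = S`, `α_k = λ_k^{1/4}` (`lemmaStrong_abs`, `lemmaStrong_fdUnit`);
* §3 **LEMMA `suddsy` (gb2)**: from (sub) on `T₀` (the `L`-block labels of `Ω_{k+1}`) and (gb1.5) on the unit sites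
  `U m T` of `T ⊇ T₀` (`Λ̃_k ⊇ Ω_{k+1}`), `suddsy_abs`: `|Φ_{k+1}| ≤ 3p_kα_k⁻¹` on `T₀` and `suddsy_fdCoarse`: `|∂_μΦ_{k+1}| ≤
  4p_k` for `u, u + e_μ ∈ T₀`, for EVERY `L = m + 1 ≥ 2` (the printed `3p_k + L⁻¹2p_k ≤ 4p_k`);
* §4 **the crossing-derivative step of (gb2.5)** (L2846–2855) with explicit constant, `crossing_bound`:
  `|L⁻¹(Φ_{k+1}(u + e_μ) − (QΦ_k)(u))| ≤ L⁻¹p_k + B` whenever (sub) holds at `u + e_μ` and `|∂_μΦ_k| ≤ B` on the translates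
  of `B(u)`;
* §5 a one-dimensional instance of every hypothesis.

**Readings / located items (declared).**  (i) "`|∂φ| ≤ p_k` on `□̃`" is read as a bound on the bonds `⟨x, x + e_μ⟩` with
BOTH ends among the fine sites `U n S` of `S` (the weakest reading; the lemmas hold a fortiori under any stronger one),
"`|∂Φ_k| ≤ 3p_k` on `□̃`" likewise for `y, y + e_μ ∈ S₀`.  (ii) The proof line L2834 prints *"|Φ_{k+1}| ≤ 3p_kα_k^{−1/4}"* where
the statement (gb2) L2815 (and the arithmetic `p_k + 2p_kα_k^{−1} ≤ 3p_kα_k^{−1}`) has `α_k^{−1}` — a located misprint,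
immaterial.  (iii) `2p_kα_k⁻¹ ≥ p_k + p_kα_k⁻¹` uses `α_k ≤ 1` (II: `α_k = max{μ̄_k^{1/2}, λ_k^{1/4}}` with `μ̄_k ≤ 1`, `λ_k ≤ 1`;
I: `λ_k` small) — an explicit hypothesis `hα1` here.  (iv) Fields are real-valued as in (yass1); the complex domains
`𝒫_k`, `ℛ_k` are not treated.

**What is NOT claimed.**  LEMMA 3.1 (2.) / 3.2 (2.) (the converse: needs the random-walk bounds (twoone1) on
`φ_{k,Ω(□)} = G_{k,Ω(□)}(…)`, §2.5), I LEMMA `strong` (2.) (`φ_k ∈ ℛ_k`), (gb1) (an assumption carried by `𝒞_{k,π}`), the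
constant `C` of (gb2.5) as a function of `p_{k−1}/p_k`, `α_{k−1}/α_k`, `L^{3/2}` (only the crossing step with its explicit
constant is given), anything of B1–B16 (TEMPLATE.md §4.2 rows «D2 Def s, Lemmas threeone, threetwo» ↔ B7 Props 1–2 / B8
§A, «D2 §3.5 … Lemma suddsy» ↔ B14 §3 (3.1)ff, grade P: covariant derivatives and plaquette variables there).  NOT
summit progress; NOT a statement about any Bałaban paper; NOT continuum; NOT Clay.  Unit `b2b-balaban-template` gen 30
(journal CLAIM D2-SMALL-FIELD-BOUNDS-KERNEL).

**Version.**  v1.0.1 — DOCSTRING-ONLY fold (every declaration and proof byte-identical to v1 p201854, 2026-08-19,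
commit 47e833839262) of the cross-read XREAD VERDICT journal l.2952 (beta-lit1-g28 on request l.2908: ok CONSISTENT 5∕5,
DOCFIX 1 LOW, INFO 3): D1 — the paper-I locator for (sk) and LEMMA `strong` is §3.2 "small fields" (TeX L1190), not
"§3.1" (= "overview" L1141): corrected in the title line, the citation header and the two `[cite:]` tags of
`lemmaStrong_abs` ∕ `lemmaStrong_fdUnit`; I1 — the global numbers (sk) = Definition 1, `strong` = Lemma 8 added; I3 —
`suddsy` = Lemma 3.4 added; I2 (the source's own "For x ⊂ □̃" L2123) left as printed.  Unit `b2b-balaban-template`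
gen 31.
-/

noncomputable section

open Finset
open Literature.MathematicalPhysics.QuantumFieldTheory.Balaban1983to89.B6QGQLower276
open Literature.MathematicalPhysics.QuantumFieldTheory.Balaban1983to89.B5Ineq167LowerZd (sum_B_add_e sub_eq_sum_range)

namespace Literature.MathematicalPhysics.QuantumFieldTheory.Dimock2011to13.SmallFieldBounds

variable {d : ℕ}

/-! ## §1 Block averages and lattice derivatives on the tree's `ℤ^d` block geometry -/

/-- **the block average** `(Q f)(y) = (n+1)^{−d} Σ_{p ∈ B(y)} f(p)` over the block of side `n + 1 = L^k` fine sites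
labelled by the unit-lattice point `y` (print: `(Q_kφ)(y) = L^{−3k}Σ_{x∈B(y)}φ(x)`, `d = 3`).
[cite: Dimock2013BalabanII, §2.1 L462–469 and §2.4 L989–994 (arXiv:1212.5562v2 TeX)] -/
def qavg (n : ℕ) (f : X d → ℝ) (y : X d) : ℝ := (((n : ℝ) + 1) ^ d)⁻¹ * ∑ p ∈ B n y, f p

/-- the forward derivative on the fine lattice of spacing `η = (n+1)⁻¹`, in integer coordinates:
`(∂_μφ)(x) = η⁻¹(φ(x + ηe_μ) − φ(x)) = (n+1)(φ(x + e_μ) − φ(x))`.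
[cite: Dimock2013BalabanII, §3.2 Definition 3.s (yass1) L2068–2069 (arXiv:1212.5562v2 TeX)] -/
def fdFine (n : ℕ) (μ : Fin d) (f : X d → ℝ) (x : X d) : ℝ := ((n : ℝ) + 1) * (f (x + e μ) - f x)

/-- the forward derivative on the unit lattice: `(∂_μΦ_k)(y) = Φ_k(y + e_μ) − Φ_k(y)`.
[cite: Dimock2013BalabanII, §3.2 Lemma 3.1 proof (base2) L2131 (arXiv:1212.5562v2 TeX)] -/
def fdUnit (μ : Fin d) (F : X d → ℝ) (y : X d) : ℝ := F (y + e μ) - F y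

/-- the forward derivative on the `L`-lattice `𝕋¹` (`L = m + 1`; its point `Lu` labelled by `u ∈ ℤ^d`):
`(∂_μΦ_{k+1})(y) = L^{−1}(Φ_{k+1}(y + Le_μ) − Φ_{k+1}(y))`.
[cite: Dimock2013BalabanII, §3.5 Lemma suddsy proof L2837 (arXiv:1212.5562v2 TeX)] -/
def fdCoarse (m : ℕ) (μ : Fin d) (F : X d → ℝ) (u : X d) : ℝ := ((m : ℝ) + 1)⁻¹ * (F (u + e μ) - F u)

/-- unfolding `qavg`. [cite: Dimock2013BalabanII, §2.1 L462–469 (arXiv:1212.5562v2 TeX)] -/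
theorem qavg_def (n : ℕ) (f : X d → ℝ) (y : X d) :
    qavg n f y = (((n : ℝ) + 1) ^ d)⁻¹ * ∑ p ∈ B n y, f p := rfl

/-- AVERAGING FACT 1: `|(Qf)(y)| ≤ M` when `|f| ≤ M` on the block `B(y)` (the step *"|Q_kφ_{k,Ω(□)}(x)| ≤ p_kα_k^{−1}"* of
(base1)). [cite: Dimock2013BalabanII, §3.2 Lemma 3.1 proof (base1) L2123–2127 (arXiv:1212.5562v2 TeX)] -/
theorem abs_qavg_le {n : ℕ} {f : X d → ℝ} {y : X d} {M : ℝ} (h : ∀ p ∈ B n y, |f p| ≤ M) :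
    |qavg n f y| ≤ M := by
  have hc : (0 : ℝ) < ((n : ℝ) + 1) ^ d := by positivity
  rw [qavg, abs_mul, abs_inv, abs_of_pos hc, inv_mul_le_iff₀ hc]
  calc |∑ p ∈ B n y, f p| ≤ ∑ p ∈ B n y, |f p| := Finset.abs_sum_le_sum_abs _ _
    _ ≤ ∑ _p ∈ B n y, M := Finset.sum_le_sum h
    _ = ((n : ℝ) + 1) ^ d * M := sum_B_const y M

/-- the block-average difference across a face as the average of the `(n+1)`-step differences:
`(Qf)(y + e_μ) − (Qf)(y) = (n+1)^{−d} Σ_{p∈B(y)} (f(p + (n+1)e_μ) − f(p))` (next-block chart `sum_B_add_e`). [folklore] -/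
private theorem qavg_add_e_sub (n : ℕ) (f : X d → ℝ) (y : X d) (μ : Fin d) :
    qavg n f (y + e μ) - qavg n f y
      = (((n : ℝ) + 1) ^ d)⁻¹ * ∑ p ∈ B n y, (f (p + ((n + 1 : ℕ) : ℤ) • e μ) - f p) := by
  rw [qavg, qavg, sum_B_add_e, ← mul_sub, Finset.sum_sub_distrib]

/-- telescoping along `e_μ`: `f(p + m e_μ) − f(p) = Σ_{t<m} (f(p + te_μ + e_μ) − f(p + te_μ))` (from
`B5Ineq167LowerZd.sub_eq_sum_range`). [folklore] -/
private theorem sub_eq_sum_steps (f : X d → ℝ) (p : X d) (μ : Fin d) (m : ℕ) :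
    f (p + (m : ℤ) • e μ) - f p
      = ∑ t ∈ Finset.range m, (f (p + (t : ℤ) • e μ + e μ) - f (p + (t : ℤ) • e μ)) := by
  rw [← neg_sub (f p), sub_eq_sum_range f p (e μ) m, ← Finset.sum_neg_distrib]
  exact Finset.sum_congr rfl fun t _ => by ring

/-- AVERAGING FACT 2: `|(Qf)(y + e_μ) − (Qf)(y)| ≤ (n+1)·D` when every single-step difference `|f(x + e_μ) − f(x)|` along
the `n+1` translates of `B(y)` towards `B(y + e_μ)` is `≤ D` (the step *"|Q_kφ(x + e_μ) − Q_kφ(x)| ≤ sup_{x∈□̃}|∂φ(x)|"* of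
(base2), with `D = η·sup|∂φ|`; and the step *"L^{−1}|(QΦ_k)(y + Le_μ) − QΦ_k(y)| ≤ 3p_k"* of Lemma suddsy, with `D = 3p_k`).
[cite: Dimock2013BalabanII, §3.2 Lemma 3.1 proof (base2) L2128–2137 and §3.5 L2837–2838 (arXiv:1212.5562v2 TeX)] -/
theorem abs_qavg_sub_le {n : ℕ} {f : X d → ℝ} {y : X d} {μ : Fin d} {D : ℝ}
    (h : ∀ p ∈ B n y, ∀ t : ℕ, t < n + 1 →
      |f (p + (t : ℤ) • e μ + e μ) - f (p + (t : ℤ) • e μ)| ≤ D) :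
    |qavg n f (y + e μ) - qavg n f y| ≤ ((n : ℝ) + 1) * D := by
  have hc : (0 : ℝ) < ((n : ℝ) + 1) ^ d := by positivity
  rw [qavg_add_e_sub, abs_mul, abs_inv, abs_of_pos hc, inv_mul_le_iff₀ hc]
  calc |∑ p ∈ B n y, (f (p + ((n + 1 : ℕ) : ℤ) • e μ) - f p)|
      ≤ ∑ p ∈ B n y, |f (p + ((n + 1 : ℕ) : ℤ) • e μ) - f p| := Finset.abs_sum_le_sum_abs _ _
    _ ≤ ∑ _p ∈ B n y, ((n : ℝ) + 1) * D := by
        refine Finset.sum_le_sum fun p hp => ?_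
        rw [sub_eq_sum_steps]
        calc |∑ t ∈ Finset.range (n + 1), (f (p + (t : ℤ) • e μ + e μ) - f (p + (t : ℤ) • e μ))|
            ≤ ∑ t ∈ Finset.range (n + 1), |f (p + (t : ℤ) • e μ + e μ) - f (p + (t : ℤ) • e μ)| :=
              Finset.abs_sum_le_sum_abs _ _
          _ ≤ ∑ _t ∈ Finset.range (n + 1), D :=
              Finset.sum_le_sum fun t ht => h p hp t (Finset.mem_range.1 ht)
          _ = ((n : ℝ) + 1) * D := by
              rw [Finset.sum_const, Finset.card_range, nsmul_eq_mul]; push_cast; ring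
    _ = ((n : ℝ) + 1) ^ d * (((n : ℝ) + 1) * D) := sum_B_const y _

/-- LATTICE FACT: a site of the block `B(y)` moved `t ≤ n + 1` steps in direction `μ` has block label `y` or `y + e_μ`.
[folklore] -/
private theorem blk_add_steps {n : ℕ} (p : X d) (μ : Fin d) {t : ℕ} (ht : t ≤ n + 1) :
    blk n (p + (t : ℤ) • e μ) = blk n p ∨ blk n (p + (t : ℤ) • e μ) = blk n p + e μ := by
  have hs : (0 : ℤ) < side n := (side_facts n).1
  have hsd : side n = (n : ℤ) + 1 := rfl
  have hdec := side_mul_blk_add_loc n p μ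
  have hl0 := loc_nonneg n p μ
  have hl1 := loc_lt n p μ
  have hμ : (p + (t : ℤ) • e μ) μ = p μ + t := by simp [Pi.add_apply]
  have hother : ∀ ν, ν ≠ μ → blk n (p + (t : ℤ) • e μ) ν = blk n p ν := by
    intro ν hν
    show (p + (t : ℤ) • e μ) ν / side n = p ν / side n
    simp [Pi.add_apply, e_apply_ne hν]
  by_cases hlt : loc n p μ + t < side n
  · left
    funext ν
    by_cases hν : ν = μ
    · subst hν
      show (p + (t : ℤ) • e ν) ν / side n = blk n p ν
      rw [hμ, show p ν + (t : ℤ) = (loc n p ν + t) + side n * blk n p ν by linarith,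
        Int.add_mul_ediv_left _ _ hs.ne', Int.ediv_eq_zero_of_lt (by omega) hlt, zero_add]
    · exact hother ν hν
  · right
    funext ν
    by_cases hν : ν = μ
    · subst hν
      show (p + (t : ℤ) • e ν) ν / side n = (blk n p + e ν) ν
      rw [hμ, show p ν + (t : ℤ) = (loc n p ν + t - side n) + side n * (blk n p ν + 1) by linarith,
        Int.add_mul_ediv_left _ _ hs.ne', Int.ediv_eq_zero_of_lt (by omega) (by omega), zero_add]
      simp [Pi.add_apply]
    · rw [hother ν hν]
      simp [Pi.add_apply, e_apply_ne hν]

/-- consequence: if the blocks `y` and `y + e_μ` both belong to `S`, every site of `B(y)` moved `t ≤ n + 1` steps in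
direction `μ` is a fine site of `S`. [folklore] -/
private theorem add_steps_mem_U {n : ℕ} {S : Finset (X d)} {p : X d} {μ : Fin d} (hp : blk n p ∈ S)
    (hpe : blk n p + e μ ∈ S) {t : ℕ} (ht : t ≤ n + 1) : p + (t : ℤ) • e μ ∈ U n S := by
  rw [mem_U]
  rcases blk_add_steps p μ ht with h | h
  · rw [h]; exact hp
  · rw [h]; exact hpe

/-- one more step: `p + te_μ + e_μ = p + (t+1)e_μ`. [folklore] -/
private theorem add_steps_succ (p : X d) (μ : Fin d) (t : ℕ) :
    p + (t : ℤ) • e μ + e μ = p + ((t + 1 : ℕ) : ℤ) • e μ := by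
  rw [Nat.cast_succ, add_smul, one_smul, add_assoc]

/-! ## §2 Definition 3.s as a predicate; Lemma 3.1 (1) = Lemma 3.2 (1) = I Lemma `strong` (1) -/

/-- **DEFINITION 3.s (yass1) as a predicate on a pair** (unit field `Φ = Φ_k`, fine field `φ`; in print `φ =
φ_{k,Ω(□)}`): `|Φ_k − Q_kφ| ≤ p_k` on the unit points `S₀` (print: `□̃ ∩ Ω_k`), `|∂φ| ≤ p_k` on the fine bonds of `S` (print:
`□̃`; reading (i)) and `|φ| ≤ p_kα_k⁻¹` on the fine sites `U n S` of `S`; block side `n + 1 = L^k`.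
[cite: Dimock2013BalabanII, §3.2 Definition 3.s (yass1) L2063–2073 (arXiv:1212.5562v2 TeX)] -/
def LocalSmallField (n : ℕ) (pk α : ℝ) (S₀ S : Finset (X d)) (Φ φ : X d → ℝ) : Prop :=
  (∀ y ∈ S₀, |Φ y - qavg n φ y| ≤ pk) ∧
    (∀ μ : Fin d, ∀ x ∈ U n S, x + e μ ∈ U n S → |fdFine n μ φ x| ≤ pk) ∧
      (∀ x ∈ U n S, |φ x| ≤ pk * α⁻¹)

/-- unfolding the predicate. [cite: Dimock2013BalabanII, §3.2 Definition 3.s (yass1) L2063–2073 (arXiv:1212.5562v2 TeX)] -/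
theorem localSmallField_iff (n : ℕ) (pk α : ℝ) (S₀ S : Finset (X d)) (Φ φ : X d → ℝ) :
    LocalSmallField n pk α S₀ S Φ φ ↔
      (∀ y ∈ S₀, |Φ y - qavg n φ y| ≤ pk) ∧
        (∀ μ : Fin d, ∀ x ∈ U n S, x + e μ ∈ U n S → |fdFine n μ φ x| ≤ pk) ∧
          (∀ x ∈ U n S, |φ x| ≤ pk * α⁻¹) := Iff.rfl

/-- (yass2): the condition for a union of cubes is the conjunction of the conditions cube by cube — for the predicate,
monotonicity in both index sets. [cite: Dimock2013BalabanII, §3.2 Definition 3.s (yass2) L2074–2077 (arXiv:1212.5562v2 TeX)] -/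
theorem LocalSmallField.mono {n : ℕ} {pk α : ℝ} {S₀ S S₀' S' : Finset (X d)} {Φ φ : X d → ℝ}
    (h : LocalSmallField n pk α S₀ S Φ φ) (h₀ : S₀' ⊆ S₀) (h₁ : S' ⊆ S) : LocalSmallField n pk α S₀' S' Φ φ := by
  have hU : U n S' ⊆ U n S := fun x hx => mem_U.2 (h₁ (mem_U.1 hx))
  exact ⟨fun y hy => h.1 y (h₀ hy), fun μ x hx hxe => h.2.1 μ x (hU hx) (hU hxe), fun x hx => h.2.2 x (hU hx)⟩

section Lemma31

variable {n : ℕ} {pk α : ℝ} {S₀ S : Finset (X d)} {Φ φ : X d → ℝ}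

/-- the step `|Q_kφ(y)| ≤ p_kα_k⁻¹` for `y ∈ S` (averaging fact 1 on `B(y) ⊆ U n S`).
[cite: Dimock2013BalabanII, §3.2 Lemma 3.1 proof (base1) L2125–2126 (arXiv:1212.5562v2 TeX)] -/
theorem abs_qavg_le_of_localSmallField (h : LocalSmallField n pk α S₀ S Φ φ) {y : X d} (hy : y ∈ S) :
    |qavg n φ y| ≤ pk * α⁻¹ :=
  abs_qavg_le fun p hp => h.2.2 p (mem_U.2 (by rwa [mem_B.1 hp]))

/-- the step `|Q_kφ(y + e_μ) − Q_kφ(y)| ≤ sup_{□̃}|∂φ| ≤ p_k` for `y, y + e_μ ∈ S` (averaging fact 2 with `D = p_k/(n+1)`: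
each fine bond on the way lies in `U n S`). [cite: Dimock2013BalabanII, §3.2 Lemma 3.1 proof (base2) L2132–2135
(arXiv:1212.5562v2 TeX)] -/
theorem abs_qavg_sub_le_of_localSmallField (h : LocalSmallField n pk α S₀ S Φ φ) {y : X d} {μ : Fin d} (hy : y ∈ S)
    (hye : y + e μ ∈ S) : |qavg n φ (y + e μ) - qavg n φ y| ≤ pk := by
  have hc : (0 : ℝ) < (n : ℝ) + 1 := by positivity
  have key : |qavg n φ (y + e μ) - qavg n φ y| ≤ ((n : ℝ) + 1) * (pk / ((n : ℝ) + 1)) := by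
    refine abs_qavg_sub_le fun p hp t ht => ?_
    have hpy : blk n p = y := mem_B.1 hp
    have hx : p + (t : ℤ) • e μ ∈ U n S := add_steps_mem_U (by rwa [hpy]) (by rwa [hpy]) ht.le
    have hxe : p + (t : ℤ) • e μ + e μ ∈ U n S := by
      rw [add_steps_succ]; exact add_steps_mem_U (by rwa [hpy]) (by rwa [hpy]) (by omega)
    have hb := h.2.1 μ _ hx hxe
    rw [fdFine, abs_mul, abs_of_pos hc] at hb
    rw [le_div_iff₀ hc, mul_comm]
    exact hb
  rwa [mul_div_cancel₀ _ hc.ne'] at key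

/-- **LEMMA 3.1 (1.), first bound (base1) = LEMMA 3.2 (1.) = I LEMMA `strong` (1.)**: `|Φ_k| ≤ 2p_kα_k⁻¹` on `S₀`, for every
pair in `𝒮_k` (predicate form) with `S₀ ⊆ S` and `0 < α_k ≤ 1`. [cite: Dimock2013BalabanII, §3.2 Lemma 3.1 (scone2)
L2103–2109 with proof (base1) L2123–2127, Lemma 3.2 (1) L2220–2226 (arXiv:1212.5562v2 TeX)] -/
theorem lemma31_abs (h : LocalSmallField n pk α S₀ S Φ φ) (hS : S₀ ⊆ S) (hα : 0 < α) (hα1 : α ≤ 1) {y : X d}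
    (hy : y ∈ S₀) : |Φ y| ≤ 2 * pk * α⁻¹ := by
  have h1 : |Φ y - qavg n φ y| ≤ pk := h.1 y hy
  have h2 : |qavg n φ y| ≤ pk * α⁻¹ := abs_qavg_le_of_localSmallField h (hS hy)
  have hpk : 0 ≤ pk := (abs_nonneg _).trans h1
  have hinv : 1 ≤ α⁻¹ := one_le_inv_iff₀.2 ⟨hα, hα1⟩
  have h3 : pk ≤ pk * α⁻¹ := by nlinarith
  calc |Φ y| = |(Φ y - qavg n φ y) + qavg n φ y| := by rw [sub_add_cancel]
    _ ≤ |Φ y - qavg n φ y| + |qavg n φ y| := abs_add_le _ _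
    _ ≤ pk + pk * α⁻¹ := add_le_add h1 h2
    _ ≤ 2 * pk * α⁻¹ := by linarith

/-- **LEMMA 3.1 (1.), second bound (base2) = LEMMA 3.2 (1.) = I LEMMA `strong` (1.)**: `|∂_μΦ_k(y)| ≤ 3p_k` whenever `y` and
`y + e_μ` are in `S₀ ⊆ S`, for every pair in `𝒮_k` (predicate form): `|Φ_k(y+e_μ) − Φ_k(y)| ≤ |Q_kφ(y+e_μ) − Q_kφ(y)| + 2p_k ≤
sup|∂φ| + 2p_k ≤ 3p_k`. [cite: Dimock2013BalabanII, §3.2 Lemma 3.1 (scone2) L2103–2109 with proof (base2) L2128–2138,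
Lemma 3.2 (1) L2220–2226 (arXiv:1212.5562v2 TeX)] -/
theorem lemma31_fdUnit (h : LocalSmallField n pk α S₀ S Φ φ) (hS : S₀ ⊆ S) {μ : Fin d} {y : X d} (hy : y ∈ S₀)
    (hye : y + e μ ∈ S₀) : |fdUnit μ Φ y| ≤ 3 * pk := by
  have h1 : |Φ (y + e μ) - qavg n φ (y + e μ)| ≤ pk := h.1 _ hye
  have h2 : |Φ y - qavg n φ y| ≤ pk := h.1 y hy
  have h3 : |qavg n φ (y + e μ) - qavg n φ y| ≤ pk := abs_qavg_sub_le_of_localSmallField h (hS hy) (hS hye)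
  have hsplit : fdUnit μ Φ y
      = (Φ (y + e μ) - qavg n φ (y + e μ)) + (qavg n φ (y + e μ) - qavg n φ y) - (Φ y - qavg n φ y) := by
    rw [fdUnit]; ring
  rw [hsplit]
  calc |(Φ (y + e μ) - qavg n φ (y + e μ)) + (qavg n φ (y + e μ) - qavg n φ y) - (Φ y - qavg n φ y)|
      ≤ |(Φ (y + e μ) - qavg n φ (y + e μ)) + (qavg n φ (y + e μ) - qavg n φ y)| + |Φ y - qavg n φ y| :=
        abs_sub _ _
    _ ≤ |Φ (y + e μ) - qavg n φ (y + e μ)| + |qavg n φ (y + e μ) - qavg n φ y| + |Φ y - qavg n φ y| :=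
        add_le_add (abs_add_le _ _) le_rfl
    _ ≤ pk + pk + pk := add_le_add (add_le_add h1 h3) h2
    _ = 3 * pk := by ring

/-- **I LEMMA `strong` (1.)** — the global case `S₀ = S` with `α_k = λ_k^{1/4}`: `Φ_k ∈ 𝒮_k ⇒ |Φ_k| ≤ 2p_kλ_k^{−1/4}`.
[cite: Dimock2013, §3.2 Lemma strong (= Lemma 8) (1) L1243–1246 with proof L1252–1256 (arXiv:1108.1335v2 TeX)] -/
theorem lemmaStrong_abs (h : LocalSmallField n pk α S S Φ φ) (hα : 0 < α) (hα1 : α ≤ 1) {y : X d} (hy : y ∈ S) :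
    |Φ y| ≤ 2 * pk * α⁻¹ :=
  lemma31_abs h subset_rfl hα hα1 hy

/-- **I LEMMA `strong` (1.)** — the global case: `Φ_k ∈ 𝒮_k ⇒ |∂_μΦ_k| ≤ 3p_k`.
[cite: Dimock2013, §3.2 Lemma strong (= Lemma 8) (1) L1243–1246 with proof L1257–1266 (arXiv:1108.1335v2 TeX)] -/
theorem lemmaStrong_fdUnit (h : LocalSmallField n pk α S S Φ φ) {μ : Fin d} {y : X d} (hy : y ∈ S)
    (hye : y + e μ ∈ S) : |fdUnit μ Φ y| ≤ 3 * pk :=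
  lemma31_fdUnit h subset_rfl hy hye

end Lemma31

/-! ## §3 Lemma `suddsy` (gb2): the bounds one level up -/

section Suddsy

variable {m : ℕ} {pk α : ℝ} {T₀ T : Finset (X d)} {Φk Φ' : X d → ℝ}

/-- **LEMMA `suddsy` (gb2), first bound**: if `|Φ_{k+1} − QΦ_k| ≤ p_k` on `T₀` ((sub); `Q` the `L`-block average, `L = m + 1`,
`T₀` the `L`-block labels of `Ω_{k+1}`) and `|Φ_k| ≤ 2p_kα_k⁻¹` on the unit sites of `T ⊇ T₀` ((gb1.5)), then `|Φ_{k+1}| ≤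
3p_kα_k⁻¹` on `T₀` (`0 < α_k ≤ 1`). [cite: Dimock2013BalabanII, §3.5 Lemma suddsy (gb2) L2808–2817 with proof L2834
(arXiv:1212.5562v2 TeX)] -/
theorem suddsy_abs (hsub : ∀ u ∈ T₀, |Φ' u - qavg m Φk u| ≤ pk) (hgb : ∀ x ∈ U m T, |Φk x| ≤ 2 * pk * α⁻¹)
    (hT : T₀ ⊆ T) (hα : 0 < α) (hα1 : α ≤ 1) {u : X d} (hu : u ∈ T₀) : |Φ' u| ≤ 3 * pk * α⁻¹ := by
  have h1 := hsub u hu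
  have h2 : |qavg m Φk u| ≤ 2 * pk * α⁻¹ :=
    abs_qavg_le fun p hp => hgb p (mem_U.2 (by rw [mem_B.1 hp]; exact hT hu))
  have hpk : 0 ≤ pk := (abs_nonneg _).trans h1
  have hinv : 1 ≤ α⁻¹ := one_le_inv_iff₀.2 ⟨hα, hα1⟩
  have h3 : pk ≤ pk * α⁻¹ := by nlinarith
  calc |Φ' u| = |(Φ' u - qavg m Φk u) + qavg m Φk u| := by rw [sub_add_cancel]
    _ ≤ |Φ' u - qavg m Φk u| + |qavg m Φk u| := abs_add_le _ _
    _ ≤ pk + 2 * pk * α⁻¹ := add_le_add h1 h2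
    _ ≤ 3 * pk * α⁻¹ := by linarith

/-- **LEMMA `suddsy` (gb2), second bound**: if moreover `|∂_μΦ_k| ≤ 3p_k` on the unit bonds of `T` ((gb1.5)) and `L = m + 1
≥ 2`, then `|∂_μΦ_{k+1}(u)| ≤ 4p_k` for `u, u + e_μ ∈ T₀`: *"|∂_μΦ_{k+1}(y)| = L^{−1}|Φ_{k+1}(y + Le_μ) − Φ_{k+1}(y)| ≤
L^{−1}|(QΦ_k)(y + Le_μ) − QΦ_k(y)| + L^{−1}2p_k ≤ 3p_k + L^{−1}2p_k ≤ 4p_k"*. [cite: Dimock2013BalabanII, §3.5 Lemma suddsy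
(gb2) L2808–2817 with proof L2835–2841 (arXiv:1212.5562v2 TeX)] -/
theorem suddsy_fdCoarse (hsub : ∀ u ∈ T₀, |Φ' u - qavg m Φk u| ≤ pk)
    (hgb' : ∀ μ : Fin d, ∀ x ∈ U m T, x + e μ ∈ U m T → |fdUnit μ Φk x| ≤ 3 * pk) (hT : T₀ ⊆ T) (hm : 1 ≤ m)
    {μ : Fin d} {u : X d} (hu : u ∈ T₀) (hue : u + e μ ∈ T₀) : |fdCoarse m μ Φ' u| ≤ 4 * pk := by
  have hL : (0 : ℝ) < (m : ℝ) + 1 := by positivity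
  have hL2 : (2 : ℝ) ≤ (m : ℝ) + 1 := by
    have : (1 : ℝ) ≤ (m : ℝ) := by exact_mod_cast hm
    linarith
  have h1 : |Φ' (u + e μ) - qavg m Φk (u + e μ)| ≤ pk := hsub _ hue
  have h2 : |Φ' u - qavg m Φk u| ≤ pk := hsub u hu
  have hpk : 0 ≤ pk := (abs_nonneg _).trans h2
  -- the middle term: averaging fact 2 with `D = 3p_k`
  have h3 : |qavg m Φk (u + e μ) - qavg m Φk u| ≤ ((m : ℝ) + 1) * (3 * pk) := by
    refine abs_qavg_sub_le fun p hp t ht => ?_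
    have hpu : blk m p = u := mem_B.1 hp
    have hx : p + (t : ℤ) • e μ ∈ U m T :=
      add_steps_mem_U (by rw [hpu]; exact hT hu) (by rw [hpu]; exact hT hue) ht.le
    have hxe : p + (t : ℤ) • e μ + e μ ∈ U m T := by
      rw [add_steps_succ]
      exact add_steps_mem_U (by rw [hpu]; exact hT hu) (by rw [hpu]; exact hT hue) (by omega)
    have hb := hgb' μ _ hx hxe
    rwa [fdUnit] at hb
  have hsplit : Φ' (u + e μ) - Φ' u
      = (Φ' (u + e μ) - qavg m Φk (u + e μ)) + (qavg m Φk (u + e μ) - qavg m Φk u) - (Φ' u - qavg m Φk u) := by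
    ring
  have h4 : |Φ' (u + e μ) - Φ' u| ≤ pk + ((m : ℝ) + 1) * (3 * pk) + pk := by
    rw [hsplit]
    calc |(Φ' (u + e μ) - qavg m Φk (u + e μ)) + (qavg m Φk (u + e μ) - qavg m Φk u) - (Φ' u - qavg m Φk u)|
        ≤ |(Φ' (u + e μ) - qavg m Φk (u + e μ)) + (qavg m Φk (u + e μ) - qavg m Φk u)| + |Φ' u - qavg m Φk u| :=
          abs_sub _ _
      _ ≤ |Φ' (u + e μ) - qavg m Φk (u + e μ)| + |qavg m Φk (u + e μ) - qavg m Φk u| + |Φ' u - qavg m Φk u| :=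
          add_le_add (abs_add_le _ _) le_rfl
      _ ≤ pk + ((m : ℝ) + 1) * (3 * pk) + pk := add_le_add (add_le_add h1 h3) h2
  rw [fdCoarse, abs_mul, abs_inv, abs_of_pos hL, inv_mul_le_iff₀ hL]
  -- `2p_k + 3Lp_k ≤ 4Lp_k` since `L ≥ 2`
  nlinarith

end Suddsy

/-! ## §4 The crossing-derivative step of (gb2.5) with explicit constant -/

/-- **(gb2.5), the crossing step**: for `Φ^#_{k+1} = (QΦ_{k,δΩ_k}, Φ_{k+1,Ω_{k+1}})`, when the bond `⟨u, u + e_μ⟩` crosses from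
`δΩ_k` into `Ω_{k+1}`: `(∂_μΦ^#_{k+1})(u) = L^{−1}(Φ_{k+1}(u + e_μ) − (QΦ_k)(u)) = L^{−1}(Φ_{k+1}(u + e_μ) − (QΦ_k)(u + e_μ)) +
L^{−1}((QΦ_k)(u + e_μ) − (QΦ_k)(u))`, the first term `≤ L^{−1}p_k` by (sub) at `u + e_μ`, the second `≤ B` when `|∂_μΦ_k| ≤
B` on the translates of `B(u)` towards `B(u + e_μ)` (averaging fact 2) — so the crossing derivative is `≤ L^{−1}p_k + B`
(print: *"bounded by Cp_k"*, with `B = Cp_k` from (gb1)/(gb1.5)). [cite: Dimock2013BalabanII, §3.5 Lemma suddsy (gb2.5)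
L2818–2821 with proof L2843–2856 (arXiv:1212.5562v2 TeX)] -/
theorem crossing_bound {m : ℕ} {pk Bk : ℝ} {Φk Φ' : X d → ℝ} {u : X d} {μ : Fin d}
    (hsub : |Φ' (u + e μ) - qavg m Φk (u + e μ)| ≤ pk)
    (hB : ∀ p ∈ B m u, ∀ t : ℕ, t < m + 1 → |fdUnit μ Φk (p + (t : ℤ) • e μ)| ≤ Bk) :
    |((m : ℝ) + 1)⁻¹ * (Φ' (u + e μ) - qavg m Φk u)| ≤ ((m : ℝ) + 1)⁻¹ * pk + Bk := by
  have hL : (0 : ℝ) < (m : ℝ) + 1 := by positivity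
  have h2 : |qavg m Φk (u + e μ) - qavg m Φk u| ≤ ((m : ℝ) + 1) * Bk := by
    refine abs_qavg_sub_le fun p hp t ht => ?_
    have hb := hB p hp t ht
    rwa [fdUnit] at hb
  have hsplit : Φ' (u + e μ) - qavg m Φk u
      = (Φ' (u + e μ) - qavg m Φk (u + e μ)) + (qavg m Φk (u + e μ) - qavg m Φk u) := by ring
  rw [abs_mul, abs_inv, abs_of_pos hL, hsplit]
  have h3 : |(Φ' (u + e μ) - qavg m Φk (u + e μ)) + (qavg m Φk (u + e μ) - qavg m Φk u)|
      ≤ pk + ((m : ℝ) + 1) * Bk := (abs_add_le _ _).trans (add_le_add hsub h2)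
  calc ((m : ℝ) + 1)⁻¹ * |(Φ' (u + e μ) - qavg m Φk (u + e μ)) + (qavg m Φk (u + e μ) - qavg m Φk u)|
      ≤ ((m : ℝ) + 1)⁻¹ * (pk + ((m : ℝ) + 1) * Bk) :=
        mul_le_mul_of_nonneg_left h3 (inv_nonneg.2 hL.le)
    _ = ((m : ℝ) + 1)⁻¹ * pk + Bk := by field_simp

/-- (gb2.5), the non-crossing part on `δΩ_k`: `QΦ_k` inherits the bound of `Φ_k` (averaging fact 1) — *"Hence QΦ_k
satisfies the same bounds on δΩ_k"*. [cite: Dimock2013BalabanII, §3.5 Lemma suddsy proof L2843–2844 (arXiv:1212.5562v2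
TeX)] -/
theorem abs_qavg_le_of_bound {m : ℕ} {A : ℝ} {Φk : X d → ℝ} {T : Finset (X d)} (hgb : ∀ x ∈ U m T, |Φk x| ≤ A)
    {u : X d} (hu : u ∈ T) : |qavg m Φk u| ≤ A :=
  abs_qavg_le fun p hp => hgb p (mem_U.2 (by rw [mem_B.1 hp]; exact hu))

/-- (gb2.5), the non-crossing derivative on `δΩ_k`: `|∂_μ(QΦ_k)(u)| = L^{−1}|(QΦ_k)(u + e_μ) − (QΦ_k)(u)| ≤ B` when `|∂_μΦ_k| ≤
B` on the unit bonds of `T ∋ u, u + e_μ` (averaging fact 2) — *"… as does"* its derivative. [cite: Dimock2013BalabanII,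
§3.5 Lemma suddsy proof L2843–2844 (arXiv:1212.5562v2 TeX)] -/
theorem abs_fdCoarse_qavg_le {m : ℕ} {Bk : ℝ} {Φk : X d → ℝ} {T : Finset (X d)}
    (hgb' : ∀ μ : Fin d, ∀ x ∈ U m T, x + e μ ∈ U m T → |fdUnit μ Φk x| ≤ Bk) {μ : Fin d} {u : X d} (hu : u ∈ T)
    (hue : u + e μ ∈ T) : |fdCoarse m μ (qavg m Φk) u| ≤ Bk := by
  have hL : (0 : ℝ) < (m : ℝ) + 1 := by positivity
  have h2 : |qavg m Φk (u + e μ) - qavg m Φk u| ≤ ((m : ℝ) + 1) * Bk := by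
    refine abs_qavg_sub_le fun p hp t ht => ?_
    have hpu : blk m p = u := mem_B.1 hp
    have hx : p + (t : ℤ) • e μ ∈ U m T := add_steps_mem_U (by rwa [hpu]) (by rwa [hpu]) ht.le
    have hxe : p + (t : ℤ) • e μ + e μ ∈ U m T := by
      rw [add_steps_succ]; exact add_steps_mem_U (by rwa [hpu]) (by rwa [hpu]) (by omega)
    have hb := hgb' μ _ hx hxe
    rwa [fdUnit] at hb
  rw [fdCoarse, abs_mul, abs_inv, abs_of_pos hL, inv_mul_le_iff₀ hL]
  exact h2

/-! ## §5 A one-dimensional instance of every hypothesis -/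

/-- the zero pair satisfies Definition 3.s with `p_k = 0`, `α_k = 1` on any index sets (`d = 1`, block side `2`), and the
lemmas return the bounds `0`. -/
example (S₀ S : Finset (X 1)) (hS : S₀ ⊆ S) (y : X 1) (hy : y ∈ S₀) :
    LocalSmallField 1 0 1 S₀ S (0 : X 1 → ℝ) (0 : X 1 → ℝ) ∧ |(0 : X 1 → ℝ) y| ≤ 2 * 0 * (1 : ℝ)⁻¹ := by
  have h : LocalSmallField 1 0 1 S₀ S (0 : X 1 → ℝ) (0 : X 1 → ℝ) := by
    refine ⟨fun y _ => ?_, fun μ x _ _ => ?_, fun x _ => ?_⟩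
    · simp [qavg]
    · simp [fdFine]
    · simp
  exact ⟨h, lemma31_abs h hS one_pos le_rfl hy⟩

/-- the hypotheses of Lemma suddsy are met by the zero fields (`L = 2`), and the conclusion is `|∂Φ_{k+1}| ≤ 0`. -/
example (T : Finset (X 1)) (u : X 1) (μ : Fin 1) (hu : u ∈ T) (hue : u + e μ ∈ T) :
    |fdCoarse 1 μ (0 : X 1 → ℝ) u| ≤ 4 * 0 :=
  suddsy_fdCoarse (T₀ := T) (Φk := 0) (fun u _ => by simp [qavg]) (fun μ x _ _ => by simp [fdUnit]) subset_rfl le_rfl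
    hu hue

end Literature.MathematicalPhysics.QuantumFieldTheory.Dimock2011to13.SmallFieldBounds

end
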